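import Summits.ABC.IUTFork.Thm311RealInd2IsmScalar
import Summits.ABC.IUTFork.Thm311RealInd2IsmSignature
import Summits.ABC.IUTFork.Cor312VolumesRealDH
import Literature.IUT.LogVolume.LogShellTopology
import HarnessLib

/-!
# [IUTchIII] Thm. 3.11 (i) (Ind2), print-literal at `𝕍^non`: PRINT'S Ism ACTS ON `K_v` BY ISOMETRIES — it moves NO
# ball of `K_v`; the non-isometry (Ind2)-mover of the indFixes record is a Dupuy–Hilado-reading phenomenon only

PROOF-ONLY file (abc-iut cell, WAVE-5 seat abc-iut-w5-d216 gen 4; TEAM R indFixes thread × abc-iut-c312-1's R8 «print's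
nonarchimedean Ism», by-name sequel of `Thm311RealInd2IsmScalar` / `Thm311RealInd2IsmSignature`); TAKES NO SIDE on
[IUTchIII] Cor. 3.12.

abc-iut-c312-1 (R8) typed print's (Ind2)-group at a finite place `v` — `Real.ismIsmOf v L` / `Real.ismIsm logv v`: the
bicontinuous automorphisms `ψ` of `K_v` REALISING a `G_v`-isometry of `O^{×μ}(G_v)` ([IUTchII] Ex. 1.8 (iv)) through the
logarithm — and proved that every such `ψ` FIXES every additive subgroup `M` with `n·Λ ⊆ M ⊆ Λ := log_v(𝒪_v^×)`
(`image_eq_of_realises_of_nsmul_mem`: norm rigidity + the units form of the local existence theorem + Hensel).  THIS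
FILE draws the metric consequence for the ANALYTIC logarithm (`LogvAnalyticAt p logv`, e.g. c312-5's `analyticLogv`):

* `image_ballSubgroup_eq_of_mem_ismIsmOf_of_le` — every closed ball `B_r = {‖a‖' ≤ r}` of `K_v^{(1/n_v)}` with
  `0 < r ≤ p⁻²` is such a sandwich (`B_r ⊆ log_p(𝒪^×)` by campaign-S `closedBall_subset_logUnits`; `p^m·log_p(𝒪^×) ⊆ B_r`
  for `m ≫ 0` since `log_p(𝒪^×)` is compact, `isCompact_logUnits`), hence `ψ(B_r) = B_r`;
* `image_ballSubgroup_eq_of_mem_ismIsmOf` — hence EVERY closed ball centred at `0` is mapped onto itself (`B_s = p^{-k}·B_{p^{-k}s}`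
  and `ψ` is additive);
* **`norm_of_map_eq_of_mem_ismIsmOf`** / **`norm_map_eq_of_mem_ismIsmOf`** — hence `ψ` is an ISOMETRY of `K_v` (rescaled
  norm `‖·‖'` and the valuation norm `|·|_v = (‖·‖')^{n_v}`, abc-iut-S7 `norm_eq_norm_of_pow`);
* **`norm_map_eq_of_mem_ismIsm`** (c312-1's `ℚ`-linear reading `Real.ismIsm logv v` on c312-5's carrier) and
  **`image_closedBall_eq_of_mem_ismIsm`**: print's (Ind2) moves NO closed ball of `K_v^{(1/n_v)}` — contrast abc-iut-w5-d180
  p432150: Dupuy–Hilado's `Aut_{ℚ_p}(K_v : I_v)` (`Real.ismDH`) moves one of `𝒪_v`, `ϖ𝒪_v` at EVERY ramified place.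

Reading for the adjudication record (§R / §A (Ind2) slot, neutral, about OUR typings): the TEAM R non-isometry mover
(p437530 `not_identifiedReading_identify_settingDHVol_of_norm_map_ne`, p441612 `…_general`: ONE `g` in the (Ind2)-slot
with `‖g z₀‖ ≠ ‖z₀‖` refutes R-1's identified-copies reading) has NO instance in print's (Ind2): its hypothesis is never
met by an element of `Real.ismIsm logv v` (`forall_norm_map_eq_of_mem_ismIsm_analyticLogv`).  What remains of the
indFixes obstruction under print's typing of (Ind2) is the (Ind1) capsule criterion (p435514) — not decided here.
Nothing here asserts that abc is proved or refuted; print's «compact topological group Ism(G)» is read with topologies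
suppressed exactly as abc-iut-L6-t2 typed it.  [claim: Mochizuki2012, status: disputed] for every [IUTchII]/[IUTchIII]
quotation; [cite: SerreLocalFields1979, Ch. XIV §6 Thm. 1]; [cite: NeukirchANT1999, Ch. II Prop. (5.5)];
[cite: DupuyHilado2025, §4.9].  Axioms: standard three.
-/

set_option autoImplicit false

noncomputable section

open Metric Set

namespace Summit.ABC.IUTFork.Thm311.Real

open NumberField IsDedekindDomain Literature.IUT.LogVolume Literature.IUT.LogThetaLattice
open Literature.NumberTheory.NumberFields

variable {F : Type} [Field F] [NumberField F] (p : ℕ) [hp : Fact p.Prime] (v : HeightOneSpectrum (𝓞 F))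
  (hv : ((p : ℕ) : 𝓞 F) ∈ v.asIdeal) {logv : PadicLogs F} (hlog : LogvAnalyticAt p logv)

/-! ## 1. Closed balls of `K_v^{(1/n_v)}` read on the carrier, and the two sandwich inputs -/

omit hp in
/-- Membership in the pulled-back closed-ball subgroup `{a ∈ K_v : ‖a‖' ≤ r}` (Mathlib's ultrametric
`closedBall_openAddSubgroup` of the rescaled completion, pulled back along the identity `RescaledCompletion.of`). [folklore] -/
theorem mem_comap_closedBall_iff {r : ℝ} (hr : 0 < r) (a : v.adicCompletion F) :
    a ∈ ((IsUltrametricDist.closedBall_openAddSubgroup (RescaledCompletion F p v hv) hr).toAddSubgroup.comap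
        (RescaledCompletion.of F p v hv).toAddMonoidHom) ↔ ‖RescaledCompletion.of F p v hv a‖ ≤ r := by
  rw [AddSubgroup.mem_comap]
  show RescaledCompletion.of F p v hv a ∈ closedBall (0 : RescaledCompletion F p v hv) r ↔ _
  rw [mem_closedBall, dist_zero_right]

include hlog in
/-- **Small balls consist of logarithms of units**: for the analytic logarithm, every `a ∈ K_v` with `‖a‖' ≤ p⁻²` is
`log_v u` for a unit `u ∈ 𝒪_v^×` (campaign-S `closedBall_subset_logUnits`: the ball `{‖z‖ ≤ p⁻²}` lies in `log_p(𝒪^×)`).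
[cite: NeukirchANT1999, Ch. II Prop. (5.5)] -/
theorem exists_unit_logv_eq_of_norm_le {a : v.adicCompletion F}
    (ha : ‖RescaledCompletion.of F p v hv a‖ ≤ (p : ℝ) ^ (-(2 : ℝ))) :
    ∃ u : (↥(integers v))ˣ, logv v (Additive.ofMul u) = a := by
  have hmem : RescaledCompletion.of F p v hv a ∈ logUnits (RescaledCompletion F p v hv) :=
    closedBall_subset_logUnits p (RescaledCompletion F p v hv) ha
  obtain ⟨y, hy, hya⟩ := hmem
  obtain ⟨u, hu⟩ := exists_unit_of_norm_eq_one v hv hy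
  refine ⟨u, ?_⟩
  rw [hlog v hv u, hu, hya]
  rfl

include hlog in
/-- **`log_v(𝒪_v^×)` is bounded** in `K_v^{(1/n_v)}` (it is compact: campaign-S `isCompact_logUnits`): there is `B ≥ 1`
with `‖log_v u‖' ≤ B` for every unit `u`. [claim: Mochizuki2012, status: disputed] -/
theorem exists_bound_norm_logv :
    ∃ B : ℝ, 1 ≤ B ∧ ∀ u : (↥(integers v))ˣ,
      ‖RescaledCompletion.of F p v hv (logv v (Additive.ofMul u))‖ ≤ B := by
  obtain ⟨C, hC⟩ := (isCompact_logUnits p (RescaledCompletion F p v hv)).isBounded.exists_norm_le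
  refine ⟨max C 1, le_max_right _ _, fun u => ?_⟩
  have hmem : RescaledCompletion.of F p v hv (logv v (Additive.ofMul u)) ∈ logUnits (RescaledCompletion F p v hv) := by
    rw [hlog v hv u]
    exact ⟨toR p v hv ((u : ↥(integers v)) : Carrier (.inr v : Place F)), norm_of_unit v hv u, rfl⟩
  exact (hC _ hmem).trans (le_max_left _ _)

/-- `‖p^m · x‖' = p^{-m} · ‖x‖'` in the rescaled completion (a normed `ℚ_p`-algebra: `‖p‖' = p⁻¹`, campaign-S
`norm_prime`). [folklore] -/
theorem norm_of_nsmul_pow (m : ℕ) (x : v.adicCompletion F) :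
    ‖RescaledCompletion.of F p v hv ((p ^ m) • x)‖ = ((p : ℝ)⁻¹) ^ m * ‖RescaledCompletion.of F p v hv x‖ := by
  rw [map_nsmul, nsmul_eq_mul, norm_mul, Nat.cast_pow, norm_pow, norm_prime p (RescaledCompletion F p v hv)]

/-! ## 2. Print's (Ind2) fixes every closed ball -/

include hlog in
/-- **SMALL BALLS ARE FIXED**: for `ψ` in print's (Ind2)-group at `v` (realising a `G_v`-isometry through the analytic
logarithm) and `0 < r ≤ p⁻²`, the ball `B_r = {‖a‖' ≤ r}` satisfies `p^m·log_v(𝒪_v^×) ⊆ B_r ⊆ log_v(𝒪_v^×)` for `m ≫ 0`,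
so abc-iut-c312-1's `image_eq_of_realises_of_nsmul_mem` gives `ψ(B_r) = B_r`. [cite: SerreLocalFields1979, Ch. XIV §6 Thm. 1]
[cite: NeukirchANT1999, Ch. II Prop. (5.5)] [claim: Mochizuki2012, status: disputed] -/
theorem image_ballSubgroup_eq_of_mem_ismIsmOf_of_le {ψ : v.adicCompletion F ≃+ v.adicCompletion F}
    (hψ : ψ ∈ ismIsmOf v (logv v)) {r : ℝ} (hr : 0 < r) (hrp : r ≤ (p : ℝ) ^ (-(2 : ℝ))) :
    ψ '' {a | ‖RescaledCompletion.of F p v hv a‖ ≤ r} = {a | ‖RescaledCompletion.of F p v hv a‖ ≤ r} := by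
  obtain ⟨-, -, φ, hφ, hreal⟩ := hψ
  set M := (IsUltrametricDist.closedBall_openAddSubgroup (RescaledCompletion F p v hv) hr).toAddSubgroup.comap
    (RescaledCompletion.of F p v hv).toAddMonoidHom with hM_def
  have hMset : (M : Set (v.adicCompletion F)) = {a | ‖RescaledCompletion.of F p v hv a‖ ≤ r} := by
    ext a
    exact mem_comap_closedBall_iff p v hv hr a
  rw [← hMset]
  -- the two sandwich inputs
  -- (the two bridges below cross from c312-5's `integers v` to Mathlib's `adicCompletionIntegers` by `rfl`)
  have hsub : (M : Set (v.adicCompletion F)) ⊆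
      Set.range fun u : (↥(v.adicCompletionIntegers F))ˣ => logv v (Additive.ofMul u) := by
    intro a ha
    have ha' : ‖RescaledCompletion.of F p v hv a‖ ≤ (p : ℝ) ^ (-(2 : ℝ)) :=
      ((mem_comap_closedBall_iff p v hv hr a).mp ha).trans hrp
    obtain ⟨u, hu⟩ := exists_unit_logv_eq_of_norm_le p v hv hlog ha'
    exact ⟨u, hu⟩
  obtain ⟨B, hB1, hB⟩ := exists_bound_norm_logv p v hv hlog
  have hBpos : 0 < B := lt_of_lt_of_le one_pos hB1
  have hp1 : ((p : ℝ)⁻¹) < 1 := inv_lt_one_of_one_lt₀ (by exact_mod_cast hp.out.one_lt)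
  have hp0 : 0 ≤ ((p : ℝ)⁻¹) := inv_nonneg.mpr (by exact_mod_cast hp.out.pos.le)
  obtain ⟨m, hm⟩ := exists_pow_lt_of_lt_one (div_pos hr hBpos) hp1
  have hpm : p ^ m ≠ 0 := pow_ne_zero m hp.out.ne_zero
  have key : ∀ u : (↥(integers v))ˣ, (p ^ m) • logv v (Additive.ofMul u) ∈ M := by
    intro u
    -- (`logv v` lands in c312-5's `Carrier (inr v)`, Mathlib's `adicCompletion` by `rfl`: no `rw` across that seam)
    refine (mem_comap_closedBall_iff p v hv hr _).mpr ((norm_of_nsmul_pow p v hv m _).trans_le ?_)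
    calc ((p : ℝ)⁻¹) ^ m * ‖RescaledCompletion.of F p v hv (logv v (Additive.ofMul u))‖
        ≤ ((p : ℝ)⁻¹) ^ m * B := mul_le_mul_of_nonneg_left (hB u) (pow_nonneg hp0 m)
      _ ≤ r := by
          have h := mul_lt_mul_of_pos_right hm hBpos
          rw [div_mul_cancel₀ r hBpos.ne'] at h
          exact h.le
  have hnsmul : ∀ u : (↥(v.adicCompletionIntegers F))ˣ, (p ^ m) • logv v (Additive.ofMul u) ∈ M :=
    fun u => key u
  exact image_eq_of_realises_of_nsmul_mem (logv v) hφ hreal hpm M hsub hnsmul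

include hlog in
/-- **EVERY CLOSED BALL IS FIXED**: for `ψ` in print's (Ind2)-group at `v` and every `s > 0`, `ψ({‖a‖' ≤ s}) = {‖a‖' ≤ s}`
(`{‖a‖' ≤ s} = {a : p^k·a ∈ B_{p^{-k}s}}` with `p^{-k}s ≤ p⁻²`, and `ψ` is additive). [cite: SerreLocalFields1979, Ch. XIV §6 Thm. 1]
[claim: Mochizuki2012, status: disputed] -/
theorem image_ballSubgroup_eq_of_mem_ismIsmOf {ψ : v.adicCompletion F ≃+ v.adicCompletion F}
    (hψ : ψ ∈ ismIsmOf v (logv v)) {s : ℝ} (hs : 0 < s) :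
    ψ '' {a | ‖RescaledCompletion.of F p v hv a‖ ≤ s} = {a | ‖RescaledCompletion.of F p v hv a‖ ≤ s} := by
  have hp1 : ((p : ℝ)⁻¹) < 1 := inv_lt_one_of_one_lt₀ (by exact_mod_cast hp.out.one_lt)
  have hp0 : 0 < ((p : ℝ)⁻¹) := inv_pos.mpr (by exact_mod_cast hp.out.pos)
  have hp2 : 0 < (p : ℝ) ^ (-(2 : ℝ)) := Real.rpow_pos_of_pos (by exact_mod_cast hp.out.pos) _
  obtain ⟨k, hk⟩ := exists_pow_lt_of_lt_one (div_pos hp2 hs) hp1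
  -- the small radius `r = p^{-k}·s`
  have hr : 0 < ((p : ℝ)⁻¹) ^ k * s := mul_pos (pow_pos hp0 k) hs
  have hrp : ((p : ℝ)⁻¹) ^ k * s ≤ (p : ℝ) ^ (-(2 : ℝ)) := by
    have h := mul_lt_mul_of_pos_right hk hs
    rw [div_mul_cancel₀ _ hs.ne'] at h
    exact h.le
  have hsmall := image_ballSubgroup_eq_of_mem_ismIsmOf_of_le p v hv hlog hψ hr hrp
  -- membership in the big ball ⟺ membership of `p^k · a` in the small ball
  have hiff : ∀ a : v.adicCompletion F, ‖RescaledCompletion.of F p v hv a‖ ≤ s ↔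
      ‖RescaledCompletion.of F p v hv ((p ^ k) • a)‖ ≤ ((p : ℝ)⁻¹) ^ k * s := by
    intro a
    rw [norm_of_nsmul_pow p v hv k a]
    exact ⟨fun h => mul_le_mul_of_nonneg_left h (pow_pos hp0 k).le, fun h => le_of_mul_le_mul_left h (pow_pos hp0 k)⟩
  apply Set.Subset.antisymm
  · rintro _ ⟨a, ha, rfl⟩
    have ha' : (p ^ k) • a ∈ {a | ‖RescaledCompletion.of F p v hv a‖ ≤ ((p : ℝ)⁻¹) ^ k * s} := (hiff a).mp ha
    have himg : ψ ((p ^ k) • a) ∈ {a | ‖RescaledCompletion.of F p v hv a‖ ≤ ((p : ℝ)⁻¹) ^ k * s} := by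
      rw [← hsmall]; exact Set.mem_image_of_mem ψ ha'
    rw [map_nsmul] at himg
    exact (hiff (ψ a)).mpr himg
  · intro b hb
    have hb' : (p ^ k) • b ∈ {a | ‖RescaledCompletion.of F p v hv a‖ ≤ ((p : ℝ)⁻¹) ^ k * s} := (hiff b).mp hb
    rw [← hsmall] at hb'
    obtain ⟨w, hw, hwb⟩ := hb'
    refine ⟨ψ.symm b, ?_, ψ.apply_symm_apply b⟩
    have hw' : w = (p ^ k) • ψ.symm b := by
      apply ψ.injective
      rw [hwb, map_nsmul, ψ.apply_symm_apply]
    rw [hw'] at hw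
    exact (hiff (ψ.symm b)).mpr hw

/-! ## 3. Print's (Ind2) acts by isometries -/

include hlog in
/-- **PRINT'S (Ind2) ACTS ON `K_v^{(1/n_v)}` BY ISOMETRIES**: `‖ψ a‖' = ‖a‖'` for every `ψ ∈ Real.ismIsmOf v (logv v)` (logv
analytic at `p`) and every `a ∈ K_v`. [cite: SerreLocalFields1979, Ch. XIV §6 Thm. 1] [claim: Mochizuki2012, status: disputed] -/
theorem norm_of_map_eq_of_mem_ismIsmOf {ψ : v.adicCompletion F ≃+ v.adicCompletion F}
    (hψ : ψ ∈ ismIsmOf v (logv v)) (a : v.adicCompletion F) :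
    ‖RescaledCompletion.of F p v hv (ψ a)‖ = ‖RescaledCompletion.of F p v hv a‖ := by
  by_cases ha0 : a = 0
  · subst ha0; rw [map_zero]
  have hψa0 : ψ a ≠ 0 := fun h => ha0 (by rw [← map_zero ψ] at h; exact ψ.injective h)
  have hsa : 0 < ‖RescaledCompletion.of F p v hv a‖ :=
    norm_pos_iff.mpr fun h => ha0 ((RescaledCompletion.of F p v hv).injective (by rw [h, map_zero]))
  have hsψ : 0 < ‖RescaledCompletion.of F p v hv (ψ a)‖ :=
    norm_pos_iff.mpr fun h => hψa0 ((RescaledCompletion.of F p v hv).injective (by rw [h, map_zero]))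
  apply le_antisymm
  · -- `a ∈ B_{‖a‖'}` hence `ψ a ∈ B_{‖a‖'}`
    have h := image_ballSubgroup_eq_of_mem_ismIsmOf p v hv hlog hψ hsa
    have hmem : ψ a ∈ {b | ‖RescaledCompletion.of F p v hv b‖ ≤ ‖RescaledCompletion.of F p v hv a‖} := by
      rw [← h]; exact Set.mem_image_of_mem ψ (Set.mem_setOf.mpr le_rfl)
    exact hmem
  · -- `ψ a ∈ B_{‖ψ a‖'}` is the image of some `w ∈ B_{‖ψ a‖'}`, and `w = a`
    have h := image_ballSubgroup_eq_of_mem_ismIsmOf p v hv hlog hψ hsψ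
    have hmem : ψ a ∈ ψ '' {b | ‖RescaledCompletion.of F p v hv b‖ ≤ ‖RescaledCompletion.of F p v hv (ψ a)‖} := by
      rw [h]; exact Set.mem_setOf.mpr le_rfl
    obtain ⟨w, hw, hwa⟩ := hmem
    rw [ψ.injective hwa] at hw
    exact hw

include hv hlog in
/-- **… and by isometries of the valuation norm `|·|_v = (‖·‖')^{n_v}`** (abc-iut-S7 `norm_eq_norm_of_pow`).
[cite: NeukirchANT1999, Ch. II Prop. (5.5)] [claim: Mochizuki2012, status: disputed] -/
theorem norm_map_eq_of_mem_ismIsmOf {ψ : v.adicCompletion F ≃+ v.adicCompletion F}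
    (hψ : ψ ∈ ismIsmOf v (logv v)) (a : v.adicCompletion F) : ‖ψ a‖ = ‖a‖ := by
  rw [RescaledCompletion.norm_eq_norm_of_pow F p v hv (ψ a), RescaledCompletion.norm_eq_norm_of_pow F p v hv a,
    norm_of_map_eq_of_mem_ismIsmOf p v hv hlog hψ a]

include hv hlog in
/-- **PRINT'S (Ind2) ON c312-5's CARRIER IS ISOMETRIC**: every element of abc-iut-c312-1's `Real.ismIsm logv v` (the
`ℚ`-linear reading of print's (Ind2)-group at `v`, `⊆ Real.ismDH logv (inr v)` by `ismIsm_subset_ismDH`) preserves the norm of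
`K_v`. [cite: SerreLocalFields1979, Ch. XIV §6 Thm. 1] [claim: Mochizuki2012, status: disputed] -/
theorem norm_map_eq_of_mem_ismIsm {ψ : Carrier (.inr v : Place F) ≃ₗ[ℚ] Carrier (.inr v : Place F)}
    (hψ : ψ ∈ ismIsm logv v) (z : Carrier (.inr v : Place F)) : ‖ψ z‖ = ‖z‖ :=
  norm_map_eq_of_mem_ismIsmOf p v hv hlog ((mem_ismIsm_iff logv v ψ).mp hψ) z

include hlog in
/-- **PRINT'S (Ind2) MOVES NO CLOSED BALL of `K_v^{(1/n_v)}`** (every radius; compare abc-iut-w5-d180 p432150: at a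
ramified place Dupuy–Hilado's `Real.ismDH` moves one of `𝒪_v`, `ϖ𝒪_v`). [cite: SerreLocalFields1979, Ch. XIV §6 Thm. 1]
[cite: DupuyHilado2025, §4.9] [claim: Mochizuki2012, status: disputed] -/
theorem image_closedBall_eq_of_mem_ismIsm {ψ : Carrier (.inr v : Place F) ≃ₗ[ℚ] Carrier (.inr v : Place F)}
    (hψ : ψ ∈ ismIsm logv v) (r : ℝ) :
    (fun a => toR p v hv (ψ (ofR p v hv a))) '' closedBall (0 : RescaledCompletion F p v hv) r = closedBall 0 r := by
  have hiso : ∀ a : RescaledCompletion F p v hv, ‖toR p v hv (ψ (ofR p v hv a))‖ = ‖a‖ := fun a =>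
    norm_of_map_eq_of_mem_ismIsmOf p v hv hlog ((mem_ismIsm_iff logv v ψ).mp hψ) (ofR p v hv a)
  ext w
  simp only [Set.mem_image, mem_closedBall_zero_iff]
  constructor
  · rintro ⟨a, ha, rfl⟩
    rw [hiso]; exact ha
  · intro hw
    refine ⟨toR p v hv (ψ.symm (ofR p v hv w)), ?_, ?_⟩
    · have h4 : ‖toR p v hv (ψ (ψ.symm (ofR p v hv w)))‖ = ‖toR p v hv (ψ.symm (ofR p v hv w))‖ := hiso _
      rw [LinearEquiv.apply_symm_apply] at h4
      rw [← h4]; exact hw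
    · exact ψ.apply_symm_apply _

/-- **TEAM R CONSEQUENCE — the non-isometry mover is absent under print's (Ind2)**: for c312-5's analytic family
`Real.analyticLogv`, EVERY element of print's (Ind2)-group at EVERY finite place is an isometry of `K_v`; so the hypothesis
`‖g z₀‖ ≠ ‖z₀‖` of the indFixes movers p437530/p441612 (met in Dupuy–Hilado's `Real.ismDH` at every ramified place) is met by
NO element of `Real.ismIsm (analyticLogv F) v`. [cite: SerreLocalFields1979, Ch. XIV §6 Thm. 1] [cite: DupuyHilado2025, §4.9]
[claim: Mochizuki2012, status: disputed] -/
theorem forall_norm_map_eq_of_mem_ismIsm_analyticLogv (v : HeightOneSpectrum (𝓞 F))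
    {g : Carrier (.inr v : Place F) ≃ₗ[ℚ] Carrier (.inr v : Place F)} (hg : g ∈ ismIsm (analyticLogv F) v)
    (z : Carrier (.inr v : Place F)) : ‖g z‖ = ‖z‖ :=
  haveI : Fact (residueChar F v).Prime := ⟨residueChar_prime F v⟩
  norm_map_eq_of_mem_ismIsm (p := residueChar F v) (v := v) (hv := natCast_residueChar_mem F v)
    (hlog := logvAnalyticAt_analyticLogv (residueChar F v)) hg z

end Summit.ABC.IUTFork.Thm311.Real

end
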